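import Summits.CriticalPhenomena.Ising3DConformalLimit.Theorems.EnergyNotSigmaSquaredMoebiusLimitExistsDefs
import Summits.CriticalPhenomena.Ising3DConformalLimit.Theorems.MoebiusLimitExists.Negative.FreeTranslations
import HarnessLib

/-!
# Translation invariance of cluster points of the pinned zoom from asymptotic equicontinuity
(line `only-interaction-breaks-moebius` of the crux `MoebiusLimitExists`, item stmt-CriticalPhenomena-1344;
registered sub-goal `pinnedZoomTranslationInvariant` of the stub `stub_compactness`)

Let `F_n(k, x) = ρ_pin(u k)ⁿ ⟨σ_{[x₁/u k]} ⋯ σ_{[xₙ/u k]}⟩_{β_c}` be the pinned zoom of the critical `ℤ³`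
spin correlators along ONE mesh sequence `u k → 0⁺` (`rescaledCorrelator (criticalCorr 3) rhoPin`), and
let `S` be a normalised locally uniform limit of `F_n(k, ·)` off the diagonals, for every `n`. If the
zoom is ASYMPTOTICALLY EQUICONTINUOUS on compact sets of non-coincident configurations (for every
`ε > 0` some `η > 0` works for all large `k`), then `S` is translation invariant:
`S_n(x + v) = S_n(x)` (`pinnedZoomTranslationInvariant`).

Proof. Off `NonCoincident` both sides vanish (normalisation; translation preserves coincidences).
On `NonCoincident`: for a mesh `δ > 0`, `[(p + v)/δ] = [p/δ] + [v/δ] + m` coordinatewise with a CARRY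
`m ∈ {0,1}³` (`⌊a⌋ + ⌊b⌋ ≤ ⌊a + b⌋ ≤ ⌊a⌋ + ⌊b⌋ + 1`), and the carry is absorbed by moving `p` to
`p + δ m`: `[(p + v)/δ] = [(p + δ m)/δ] + [v/δ]`. By the exact lattice translation invariance of the
critical state (`criticalCorr_translate`, Friedli–Velenik 2017 Thm. 3.17, landed in
`…MoebiusLimitExists.Negative.FreeTranslations`), `F_n(k, x + v) = F_n(k, y_k)` EXACTLY for a
configuration `y_k` with `dist(y_k, x) ≤ 2 u k → 0`. Asymptotic equicontinuity on a compact ball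
around `x` inside the open set `NonCoincident` then forces the two limits `S_n(x)` (of `F_n(k, x)`) and
`S_n(x + v)` (of `F_n(k, y_k)`) to be `ε`-close for every `ε > 0`.

References: S. Friedli, Y. Velenik, *Statistical Mechanics of Lattice Systems* (CUP 2017), Thm. 3.17
(translation invariance of `⟨·⟩⁺_β`); the equicontinuity argument is folklore (Arzelà–Ascoli type).
No definitions are introduced.
-/

noncomputable section

open Filter Topology Set Function
open Literature.Probability.LatticeModels

namespace Summit.CriticalPhenomena.Ising3DConformalLimit.MoebiusLimitExistsOnlyInteraction

open Summit.CriticalPhenomena.Ising3DConformalLimit.MoebiusLimitExistsNegative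
  (criticalCorr_translate add_mem_nonCoincident_iff latticeApprox_add_natMul_smul)

/-! ### The carry of a lattice approximation under translation -/

/-- **Carry identity.** For `δ > 0` and points `p, v ∈ ℝ³`, with the carry
`m = [(p+v)/δ] − [p/δ] − [v/δ] ∈ ℤ³`: `[(p + v)/δ] = [(p + δ m)/δ] + [v/δ]`
(since `[(p + δ m)/δ] = [p/δ] + m`). [folklore] -/
theorem latticeApprox_add_eq_carry {δ : ℝ} (hδ : 0 < δ) (p v : EuclideanSpace ℝ (Fin 3)) :
    latticeApprox δ (p + v) =
      latticeApprox δ (p + δ • siteVec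
          (latticeApprox δ (p + v) - latticeApprox δ p - latticeApprox δ v)) + latticeApprox δ v := by
  have h := latticeApprox_add_natMul_smul hδ p
    (latticeApprox δ (p + v) - latticeApprox δ p - latticeApprox δ v) 1
  simp only [Nat.cast_one, one_mul, one_smul] at h
  rw [h]
  abel

/-- The carry has coordinates in `{0, 1}`: `0 ≤ ⌊a + b⌋ − ⌊a⌋ − ⌊b⌋ ≤ 1`. [folklore] -/
theorem carry_apply_mem (δ : ℝ) (p v : EuclideanSpace ℝ (Fin 3)) (j : Fin 3) :
    0 ≤ (latticeApprox δ (p + v) - latticeApprox δ p - latticeApprox δ v) j ∧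
      (latticeApprox δ (p + v) - latticeApprox δ p - latticeApprox δ v) j ≤ 1 := by
  simp only [Pi.sub_apply, latticeApprox_apply, PiLp.add_apply, add_div]
  constructor
  · have := Int.le_floor_add (p j / δ) (v j / δ); omega
  · have := Int.le_floor_add_floor (p j / δ) (v j / δ); omega

/-- Moving every point of a configuration by `δ ≥ 0` times a lattice vector with coordinates in
`{0, 1}` moves the configuration by at most `2δ` (sup over the points of Euclidean distances, each
`≤ δ√3`). [folklore] -/
theorem dist_add_smul_siteVec_le {n : ℕ} {δ : ℝ} (hδ : 0 ≤ δ)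
    (x : Fin n → EuclideanSpace ℝ (Fin 3)) (m : Fin n → Site 3)
    (hm : ∀ i j, 0 ≤ m i j ∧ m i j ≤ 1) :
    dist (fun i => x i + δ • siteVec (m i)) x ≤ 2 * δ := by
  refine (dist_pi_le_iff (by positivity)).2 fun i => ?_
  show dist (x i + δ • siteVec (m i)) (x i) ≤ 2 * δ
  rw [dist_self_add_left, norm_smul, Real.norm_eq_abs, abs_of_nonneg hδ, mul_comm]
  refine mul_le_mul_of_nonneg_right ?_ hδ
  rw [EuclideanSpace.norm_eq, Real.sqrt_le_left (by norm_num : (0:ℝ) ≤ 2)]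
  have h : ∀ j, ‖siteVec (m i) j‖ ^ 2 ≤ 1 := by
    intro j
    rw [siteVec_apply, Real.norm_eq_abs, sq_abs]
    obtain ⟨h0, h1⟩ := hm i j
    have h0' : (0:ℝ) ≤ m i j := by exact_mod_cast h0
    have h1' : (m i j : ℝ) ≤ 1 := by exact_mod_cast h1
    nlinarith
  calc ∑ j, ‖siteVec (m i) j‖ ^ 2 ≤ ∑ _j : Fin 3, (1:ℝ) := Finset.sum_le_sum fun j _ => h j
    _ ≤ 2 ^ 2 := by norm_num

/-- **Translation is a small perturbation at the lattice level.** For `δ > 0`, any renormalisation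
`ρ`, any configuration `x` and any `v ∈ ℝ³` there is a configuration `y` with `dist(y, x) ≤ 2δ` and
`ρ(δ)ⁿ⟨∏ σ_{[(xᵢ+v)/δ]}⟩_{β_c} = ρ(δ)ⁿ⟨∏ σ_{[yᵢ/δ]}⟩_{β_c}` EXACTLY: absorb the carries into `x`
and use the lattice translation invariance of the critical state (`criticalCorr_translate`).
[cite: FriedliVelenik2017, Thm. 3.17] -/
theorem exists_rescaledCorrelator_translate_eq {n : ℕ} {δ : ℝ} (hδ : 0 < δ) (ρ : ℝ → ℝ)
    (x : Fin n → EuclideanSpace ℝ (Fin 3)) (v : EuclideanSpace ℝ (Fin 3)) :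
    ∃ y : Fin n → EuclideanSpace ℝ (Fin 3), dist y x ≤ 2 * δ ∧
      rescaledCorrelator (criticalCorr 3) ρ n δ (fun i => x i + v) =
        rescaledCorrelator (criticalCorr 3) ρ n δ y := by
  refine ⟨fun i => x i + δ • siteVec
      (latticeApprox δ (x i + v) - latticeApprox δ (x i) - latticeApprox δ v), ?_, ?_⟩
  · exact dist_add_smul_siteVec_le hδ.le x _ fun i j => carry_apply_mem δ (x i) v j
  · simp only [rescaledCorrelator_apply]
    congr 1
    calc criticalCorr 3 n (fun i => latticeApprox δ (x i + v))
        = criticalCorr 3 n (fun i => latticeApprox δ (x i + δ • siteVec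
            (latticeApprox δ (x i + v) - latticeApprox δ (x i) - latticeApprox δ v))
              + latticeApprox δ v) := by
          congr 1
          funext i
          exact latticeApprox_add_eq_carry hδ (x i) v
      _ = _ := criticalCorr_translate _ _

/-! ### Asymptotic equicontinuity identifies limits along asymptotically close points -/

/-- **Asymptotic equicontinuity transfers limits.** If the functions `F k` are asymptotically
equicontinuous on `K` (for every `ε > 0` some `η > 0` works for all large `k`), `x ∈ K`, `y k ∈ K`
eventually with `dist(y k, x) → 0`, `F k x → a` and `F k (y k) → b`, then `a = b`. [folklore] -/
theorem eq_of_asympEquicontinuous {X : Type*} [PseudoMetricSpace X] {F : ℕ → X → ℝ} {K : Set X}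
    (hequi : ∀ ε > 0, ∃ η > 0, ∀ᶠ k in atTop, ∀ x ∈ K, ∀ y ∈ K, dist x y < η →
      |F k x - F k y| < ε)
    {x : X} {y : ℕ → X} (hxK : x ∈ K) (hyK : ∀ᶠ k in atTop, y k ∈ K)
    (hyx : Tendsto (fun k => dist (y k) x) atTop (𝓝 0))
    {a b : ℝ} (ha : Tendsto (fun k => F k x) atTop (𝓝 a))
    (hb : Tendsto (fun k => F k (y k)) atTop (𝓝 b)) : a = b := by
  refine eq_of_forall_dist_le fun ε hε => ?_
  obtain ⟨η, hη, hev⟩ := hequi ε hε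
  have hd : Tendsto (fun k => dist (F k x) (F k (y k))) atTop (𝓝 (dist a b)) := ha.dist hb
  refine le_of_tendsto hd ?_
  filter_upwards [hev, hyK, hyx.eventually_lt_const hη] with k hk hyk hlt
  rw [Real.dist_eq]
  refine (hk x hxK (y k) hyk ?_).le
  rwa [dist_comm]

/-! ### The registered sub-goal -/

/-- **Translation invariance of cluster points of the pinned zoom under asymptotic equicontinuity**
(registered sub-goal `pinnedZoomTranslationInvariant` of `stub_compactness`, line
`only-interaction-breaks-moebius`). Along one mesh sequence `u k → 0⁺`, if the pinned zoom
`ρ_pin(u k)ⁿ⟨∏ σ_{[xᵢ/u k]}⟩_{β_c}` is asymptotically equicontinuous on compact sets of non-coincident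
configurations, then every normalised locally uniform limit `S` (off the diagonals, all `n`) is
translation invariant. Mechanism: a translation by `v` moves all lattice approximations by the common
lattice vector `[v/u k]` up to carries in `{0,1}³`, which are absorbed by an `O(u k)`-perturbation of
`x` (`exists_rescaledCorrelator_translate_eq`, via `criticalCorr_translate`); equicontinuity kills
the perturbation in the limit (`eq_of_asympEquicontinuous`). [cite: FriedliVelenik2017, Thm. 3.17] -/
theorem pinnedZoomTranslationInvariant :
    ∀ u : ℕ → ℝ, Tendsto u atTop (𝓝[>] (0 : ℝ)) →
      (∀ n (K : Set (Fin n → EuclideanSpace ℝ (Fin 3))), IsCompact K → K ⊆ NonCoincident 3 n →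
        ∀ ε > 0, ∃ η > 0, ∀ᶠ k in atTop, ∀ x ∈ K, ∀ y ∈ K, dist x y < η →
          |rescaledCorrelator (criticalCorr 3) rhoPin n (u k) x - rescaledCorrelator (criticalCorr 3) rhoPin n (u k) y| < ε) →
      ∀ S : CorrFamily 3, IsNormalised S →
        (∀ n, TendstoLocallyUniformlyOn (fun k => rescaledCorrelator (criticalCorr 3) rhoPin n (u k)) (S n) atTop
          (NonCoincident 3 n)) →
        IsTranslationInvariant S := by
  intro u hu hequi S hnorm hconv n v x
  by_cases hx : x ∈ NonCoincident 3 n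
  swap
  · rw [hnorm n x hx, hnorm n _ (mt (add_mem_nonCoincident_iff v x).1 hx)]
  have hxv : (fun i => x i + v) ∈ NonCoincident 3 n := (add_mem_nonCoincident_iff v x).2 hx
  have hu0 : Tendsto u atTop (𝓝 0) := (tendsto_nhdsWithin_iff.1 hu).1
  have hupos : ∀ᶠ k in atTop, 0 < u k := (tendsto_nhdsWithin_iff.1 hu).2
  -- a compact ball around `x` inside the open set `NonCoincident`
  obtain ⟨r, hr, hball⟩ := Metric.isOpen_iff.1 (isOpen_nonCoincident 3 n) x hx
  have hKsub : Metric.closedBall x (r / 2) ⊆ NonCoincident 3 n :=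
    (Metric.closedBall_subset_ball (by linarith)).trans hball
  -- the perturbed configurations `y k`, `2 u k`-close to `x`, carrying the translate exactly
  have hy : ∀ k, ∃ y : Fin n → EuclideanSpace ℝ (Fin 3), 0 < u k →
      dist y x ≤ 2 * u k ∧
        rescaledCorrelator (criticalCorr 3) rhoPin n (u k) (fun i => x i + v) =
          rescaledCorrelator (criticalCorr 3) rhoPin n (u k) y := by
    intro k
    by_cases hk : 0 < u k
    · obtain ⟨y, h1, h2⟩ := exists_rescaledCorrelator_translate_eq hk rhoPin x v
      exact ⟨y, fun _ => ⟨h1, h2⟩⟩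
    · exact ⟨x, fun h => absurd h hk⟩
  choose y hy using hy
  have hyev : ∀ᶠ k in atTop, dist (y k) x ≤ 2 * u k ∧
      rescaledCorrelator (criticalCorr 3) rhoPin n (u k) (fun i => x i + v) =
        rescaledCorrelator (criticalCorr 3) rhoPin n (u k) (y k) :=
    hupos.mono fun k hk => hy k hk
  have hyx : Tendsto (fun k => dist (y k) x) atTop (𝓝 0) := by
    refine squeeze_zero' (Eventually.of_forall fun k => dist_nonneg) (hyev.mono fun k hk => hk.1) ?_
    simpa using hu0.const_mul 2
  have hyK : ∀ᶠ k in atTop, y k ∈ Metric.closedBall x (r / 2) :=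
    (hyx.eventually_lt_const (half_pos hr)).mono fun k hk => Metric.mem_closedBall.2 hk.le
  -- the two limits
  have h1 : Tendsto (fun k => rescaledCorrelator (criticalCorr 3) rhoPin n (u k) x) atTop
      (𝓝 (S n x)) := (hconv n).tendsto_at hx
  have h2 : Tendsto (fun k => rescaledCorrelator (criticalCorr 3) rhoPin n (u k) (y k)) atTop
      (𝓝 (S n fun i => x i + v)) := by
    refine ((hconv n).tendsto_at hxv).congr' ?_
    filter_upwards [hyev] with k hk
    exact hk.2
  exact (eq_of_asympEquicontinuous (hequi n _ (isCompact_closedBall x (r / 2)) hKsub)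
    (Metric.mem_closedBall_self (by positivity)) hyK hyx h1 h2).symm

end Summit.CriticalPhenomena.Ising3DConformalLimit.MoebiusLimitExistsOnlyInteraction

end
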